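import Summits.CriticalPhenomena.PercolationContinuityZ3.Theorems.PercNearOneGluingNoHeavyLowerTailFourPointRowsLeFive
import Summits.CriticalPhenomena.PercolationContinuityZ3.Theorems.PercNearOneGluingNoHeavyLowerTailCubicThreePointBernsteinStep
import Literature.Probability.LatticeModels.SahiThirdOrderCorrelation

/-!
# `NoHeavyLowerTail` (crux stmt-CriticalPhenomena-4575): the SHK3⁺ terminal-edge step — the polarised rows (L1),(L2) and the
# Bernstein pieces (B1),(B2) — holds on every weighted graph with at most five vertices, for ALL edge weights; kernel-checked, and
# three-copy FIBREWISE (Richards-comb) positive   (bounded-n kernel theorem, rung N₀ = 5)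

Support file (prover seat `prim-bnk-1`, bounded-n kernel theorems; `--supports stmt-CriticalPhenomena-4575`; COMPUTATIONAL: the eight
`checkC` evaluations and the two relabelling covers use `native_decide`).

SETTING (run/shared/lean/ttrl/bern4/README "POLARIZATION L1/L2"; tree `…CubicThreePointBernsteinStep`, `…CubicThreePointPolarization`).
Four marked vertices `a, b, c, y` of a finite weighted graph, `μ = prodBernoulli w`; `D_uv = {u ↮ v}`, `G_ab = {b ↮ a, b ↮ y}`,
`G_ac = {c ↮ a, c ↮ y}`, `G_bc = {b ↮ c} ∖ ({a↔b, c↔y} ∪ {a↔c, b↔y})` (= "b ↮ c after gluing a and y"), `β₃ = μ(a|bcy)`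
(`a` cut from `b`, and `b ↔ c`, `b ↔ y`), `E₃ = sahiE3 μ` the Richards–Sahi functional.  The terminal-edge Bernstein induction for
SHK3⁺ = 3PT-LB (`F_segment_nonneg_of_bernstein`, `shk3_of_stepHyp`) needs, along the apex edge `e = {a,y}` of `G = G' + e`, the two
4-point inequalities (B1) `threeB₁ ≥ 0`, (B2) `threeB₂ ≥ 0` at the cells of `G'`; by the polarization identities (`threeB₁_polarization`)
these follow from (and are numerically equivalent to, given the proved rows) the POLARISED rows
  (L1)  `E₃(D_bc, D_ac, G_ab) + E₃(D_bc, G_ac, D_ab) ≥ β₃ · μ(D_bc)`,      (L2)  `E₃(D_bc, G_ac, G_ab) + E₃(D_bc, D_ac, G_ab) + E₃(D_bc, G_ac, D_ab) ≥ β₃ · μ(G_bc)`,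
which hold with 0 violations on 3.13·10⁶ exact weighted instances (all supports `n ≤ 7`), are tight exactly on the cut-vertex / star / isolated /
disconnected face, and have NO law-level certificate of degree ≤ 5 over the proved row cone (ttrl2 bern4/SDP.md).

**Theorems** (`∀ n ≤ 5`, every `w : Sym2 (Fin n) → [0,1]`, all pairwise distinct `a b c y : Fin n`):
* `l1_le_five`, `l2_le_five` — (L1), (L2) in `sahiE3` notation;
* `bernsteinStep_le_five` — `0 ≤ threeB₁ q u₁ u₂ u₃ t α₁ α₂ β₁ β₂ β₃ ∧ 0 ≤ threeB₂ …` with the ten arguments the `μ`-probabilities of the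
  three-point cells of `(a,b,c)` and of the five apex transition events (`α₁ = μ(a|b|c ∧ y↔b)`, …, `β₃ = μ(bc|a ∧ y↔b)`), i.e. exactly the
  hypotheses `h₁, h₂` of `CubicThreePointStep.F_segment_nonneg_of_bernstein` for the graph `G' ∪ {a,y}`;
* the named bounded-n statements `PolarisedStepUpTo N₀`, `BernsteinStepUpTo N₀` and `polarisedStepUpTo_five`, `bernsteinStepUpTo_five`.
PROOF.  Each of the four rows is a signed cubic form in products of `μ`-probabilities of connectivity events (`qTerms`; rows 2, 3 are the
monomial expansions of `threeB₁`, `threeB₂`, checked against the tree polynomials by `ring` in `cval_qTerms_two/three`).  The generic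
three-copy checker `checkC` of `…E3GroupSepCertCheck` (prim-cert-2) verifies that ALL `4^m` tensor-Bernstein fibre sums of each form are
nonnegative on `K₄` (`m = 6`) and `K₅` (`m = 10`) at the standard quadruple (`native_decide`), whence nonnegativity at every weight vector
(`checkC_sound`); the other quadruples follow by transport along vertex relabellings.  So on `≤ 5` vertices the four rows are Richards-comb
positive — STRONGER than (L1),(L2),(B1),(B2) there, and the signature of a three-copy switching proof (as for SHK3⁺ itself, prim-lit-2 PROOF-3PTLB).
Independent exact recomputation of all fibre sums (C, two implementations; 0 negative fibres of 4⁶ resp. 4¹⁰ for L1, L2, B1, B2; e.g. L1 on K₅: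
814 233 zero and 234 343 positive fibres): run/shared/lean/prim/prim-l12/prim-bnk-1/.  Nothing is claimed beyond five vertices (K₆: kit census).
-/

namespace Summit.CriticalPhenomena.PercolationContinuityZ3.Theorems.TerminalEdgeStep

open Finset MeasureTheory OneCutCert CovTransferCert E3GroupSepCert CubicThreePointStep
open scoped BigOperators
open Literature.Probability.Percolation Literature.Probability.LatticeModels

variable {n : ℕ}

/-! ## Events of the four marked vertices `(a, b, c, y)` -/

/-- `D_uv = {u ↮ v}`. [this work] -/
def pD (u v : Fin n) : CRel n → Bool := fun r => !(r u v)
/-- `G_ab = {b ↮ a, b ↮ y}` (`b` cut from the glued vertex `ay`); `G_ac` is `pG a c y`. [this work] -/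
def pG (a b y : Fin n) : CRel n → Bool := fun r => !(r a b) && !(r y b)
/-- `G_bc = {b ↮ c in G/ay} = {b ↮ c} ∖ ({a↔b, c↔y} ∪ {a↔c, b↔y})`. [this work] -/
def pGbc (a b c y : Fin n) : CRel n → Bool := fun r => !(r b c) && !(r a b && r c y || r a c && r b y)
/-- `α₁`: cell `a|by|c` = `a|b|c ∧ y ↔ b` (transition `a|b|c → ab|c` through the apex edge `{a,y}`). [this work] -/
def pA₁ (a b c y : Fin n) : CRel n → Bool := fun r => pQ a b c r && r y b
/-- `α₂`: cell `a|b|cy` = `a|b|c ∧ y ↔ c`. [this work] -/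
def pA₂ (a b c y : Fin n) : CRel n → Bool := fun r => pQ a b c r && r y c
/-- `β₁`: cell `ab|cy` = `ab|c ∧ c ↔ y`. [this work] -/
def pB₁ (a b c y : Fin n) : CRel n → Bool := fun r => pU₁ a b c r && r c y
/-- `β₂`: cell `ac|by` = `ac|b ∧ b ↔ y`. [this work] -/
def pB₂ (a b c y : Fin n) : CRel n → Bool := fun r => pU₂ a b c r && r b y
/-- `β₃`: cell `a|bcy` = `bc|a ∧ b ↔ y`. [this work] -/
def pB₃ (a b c y : Fin n) : CRel n → Bool := fun r => pU₃ a b c r && r b y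

/-- The cubic term lists of the four rows at `(a,b,c,y)`: `0` = (L1), `1` = (L2) (in `e3Terms`), `2` = (B1) = the monomials of `threeB₁`,
`3` = (B2) = the monomials of `threeB₂`, in the ten event variables `Q,U₁,U₂,U₃,T,A₁,A₂,B₁,B₂,B₃`. [this work] -/
def qTerms (i : Fin 4) (x : Quad n) : List (CTerm n) :=
  let a := x.1
  let b := x.2.1
  let c := x.2.2.1
  let y := x.2.2.2
  let Q := pQ a b c
  let U₁ := pU₁ a b c
  let U₂ := pU₂ a b c
  let U₃ := pU₃ a b c
  let T := pT a b c
  let A₁ := pA₁ a b c y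
  let A₂ := pA₂ a b c y
  let B₁ := pB₁ a b c y
  let B₂ := pB₂ a b c y
  let B₃ := pB₃ a b c y
  match i with
  | 0 => e3Terms (pD b c) (pD a c) (pG a b y) ++ e3Terms (pD b c) (pG a c y) (pD a b) ++ [(-1, pTrue, B₃, pD b c)]
  | 1 => e3Terms (pD b c) (pG a c y) (pG a b y) ++ e3Terms (pD b c) (pD a c) (pG a b y) ++ e3Terms (pD b c) (pG a c y) (pD a b) ++
      [(-1, pTrue, B₃, pGbc a b c y)]
  | 2 =>
    [(3, Q, Q, T), (1, Q, Q, B₁), (1, Q, Q, B₂), (1, Q, Q, B₃), (-3, Q, U₁, U₂), (-3, Q, U₁, U₃), (3, Q, U₁, T),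
      (-1, Q, U₁, A₂), (1, Q, U₁, B₁), (2, Q, U₁, B₂), (2, Q, U₁, B₃), (-3, Q, U₂, U₃), (3, Q, U₂, T), (-1, Q, U₂, A₁),
      (2, Q, U₂, B₁), (1, Q, U₂, B₂), (2, Q, U₂, B₃), (3, Q, U₃, T), (-1, Q, U₃, A₁), (-1, Q, U₃, A₂), (2, Q, U₃, B₁),
      (2, Q, U₃, B₂), (1, Q, U₃, B₃), (6, Q, T, T), (-1, Q, T, A₁), (-1, Q, T, A₂), (3, Q, T, B₁), (3, Q, T, B₂),
      (3, Q, T, B₃), (-3, U₁, U₁, U₂), (-3, U₁, U₁, U₃), (-1, U₁, U₁, A₂), (1, U₁, U₁, B₂), (1, U₁, U₁, B₃), (-3, U₁, U₂, U₂),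
      (-12, U₁, U₂, U₃), (-6, U₁, U₂, T), (-1, U₁, U₂, A₁), (-1, U₁, U₂, A₂), (2, U₁, U₂, B₃), (-3, U₁, U₃, U₃),
      (-6, U₁, U₃, T), (-1, U₁, U₃, A₁), (-3, U₁, U₃, A₂), (2, U₁, U₃, B₂), (-1, U₁, T, A₁), (-3, U₁, T, A₂), (2, U₁, T, B₂),
      (2, U₁, T, B₃), (-3, U₂, U₂, U₃), (-1, U₂, U₂, A₁), (1, U₂, U₂, B₁), (1, U₂, U₂, B₃), (-3, U₂, U₃, U₃), (-6, U₂, U₃, T),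
      (-3, U₂, U₃, A₁), (-1, U₂, U₃, A₂), (2, U₂, U₃, B₁), (-3, U₂, T, A₁), (-1, U₂, T, A₂), (2, U₂, T, B₁), (2, U₂, T, B₃),
      (-1, U₃, U₃, A₁), (-1, U₃, U₃, A₂), (1, U₃, U₃, B₁), (1, U₃, U₃, B₂), (-3, U₃, T, A₁), (-3, U₃, T, A₂), (2, U₃, T, B₁),
      (2, U₃, T, B₂), (-2, T, T, A₁), (-2, T, T, A₂)]
  | 3 =>
    [(3, Q, Q, T), (2, Q, Q, B₁), (2, Q, Q, B₂), (2, Q, Q, B₃), (-3, Q, U₁, U₂), (-3, Q, U₁, U₃), (3, Q, U₁, T),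
      (-2, Q, U₁, A₂), (2, Q, U₁, B₁), (4, Q, U₁, B₂), (4, Q, U₁, B₃), (-3, Q, U₂, U₃), (3, Q, U₂, T), (-2, Q, U₂, A₁),
      (4, Q, U₂, B₁), (2, Q, U₂, B₂), (4, Q, U₂, B₃), (3, Q, U₃, T), (-2, Q, U₃, A₁), (-2, Q, U₃, A₂), (4, Q, U₃, B₁),
      (4, Q, U₃, B₂), (2, Q, U₃, B₃), (6, Q, T, T), (-2, Q, T, A₁), (-2, Q, T, A₂), (6, Q, T, B₁), (6, Q, T, B₂),
      (6, Q, T, B₃), (-1, Q, A₁, A₂), (-1, Q, A₁, B₁), (-1, Q, A₂, B₂), (1, Q, B₁, B₁), (1, Q, B₁, B₂), (1, Q, B₁, B₃),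
      (1, Q, B₂, B₂), (1, Q, B₂, B₃), (1, Q, B₃, B₃), (-3, U₁, U₁, U₂), (-3, U₁, U₁, U₃), (-2, U₁, U₁, A₂), (2, U₁, U₁, B₂),
      (2, U₁, U₁, B₃), (-3, U₁, U₂, U₂), (-12, U₁, U₂, U₃), (-6, U₁, U₂, T), (-2, U₁, U₂, A₁), (-2, U₁, U₂, A₂),
      (4, U₁, U₂, B₃), (-3, U₁, U₃, U₃), (-6, U₁, U₃, T), (-2, U₁, U₃, A₁), (-6, U₁, U₃, A₂), (4, U₁, U₃, B₂), (-2, U₁, T, A₁),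
      (-6, U₁, T, A₂), (4, U₁, T, B₂), (4, U₁, T, B₃), (-1, U₁, A₁, A₂), (-1, U₁, A₁, B₁), (-1, U₁, A₂, B₁), (-2, U₁, A₂, B₂),
      (1, U₁, B₂, B₂), (1, U₁, B₃, B₃), (-3, U₂, U₂, U₃), (-2, U₂, U₂, A₁), (2, U₂, U₂, B₁), (2, U₂, U₂, B₃), (-3, U₂, U₃, U₃),
      (-6, U₂, U₃, T), (-6, U₂, U₃, A₁), (-2, U₂, U₃, A₂), (4, U₂, U₃, B₁), (-6, U₂, T, A₁), (-2, U₂, T, A₂), (4, U₂, T, B₁),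
      (4, U₂, T, B₃), (-1, U₂, A₁, A₂), (-2, U₂, A₁, B₁), (-1, U₂, A₁, B₂), (-1, U₂, A₂, B₂), (1, U₂, B₁, B₁), (1, U₂, B₃, B₃),
      (-2, U₃, U₃, A₁), (-2, U₃, U₃, A₂), (2, U₃, U₃, B₁), (2, U₃, U₃, B₂), (-6, U₃, T, A₁), (-6, U₃, T, A₂), (4, U₃, T, B₁),
      (4, U₃, T, B₂), (-2, U₃, A₁, A₂), (-2, U₃, A₁, B₁), (-1, U₃, A₁, B₃), (-2, U₃, A₂, B₂), (-1, U₃, A₂, B₃),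
      (1, U₃, B₁, B₁), (1, U₃, B₂, B₂), (-4, T, T, A₁), (-4, T, T, A₂), (-2, T, A₁, A₂), (-3, T, A₁, B₁), (-1, T, A₁, B₂),
      (-1, T, A₁, B₃), (-1, T, A₂, B₁), (-3, T, A₂, B₂), (-1, T, A₂, B₃), (-2, T, B₁, B₂), (-2, T, B₁, B₃), (-2, T, B₂, B₃)]

/-- Row `i` holds at `(w, x)`: its cubic form is nonnegative. [this work] -/
def QRowHolds (i : Fin 4) (w : Sym2 (Fin n) → unitInterval) (x : Quad n) : Prop := 0 ≤ cval w (qTerms i x)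

/-! ## Transport along vertex relabellings -/

/-- The row terms under relabelling. [this work] -/
theorem qTerms_relP (i : Fin 4) (τ : Fin n ≃ Fin n) (x : Quad n) :
    ((qTerms i x).map fun z => (z.1, relP τ z.2.1, relP τ z.2.2.1, relP τ z.2.2.2)) = qTerms i (quadmap τ x) := by
  obtain ⟨a, b, c, y⟩ := x
  fin_cases i <;> rfl

/-- **A row is transported along a relabelling of the vertices.** [this work] -/
theorem qRowHolds_relabel (i : Fin 4) (σ : Fin n ≃ Fin n) (w : Sym2 (Fin n) → unitInterval) (x : Quad n)
    (h : QRowHolds i w x) : QRowHolds i (relabelW σ w) (quadmap σ x) := by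
  unfold QRowHolds at h ⊢
  rw [cval_map_relP, qTerms_relP, quadmap_symm_quadmap]
  exact h

/-- A row at all weights for a quadruple gives the row at all weights for every relabelled quadruple. [this work] -/
theorem qRowHolds_forall_relabel (i : Fin 4) (σ : Fin n ≃ Fin n) {x : Quad n}
    (h : ∀ w : Sym2 (Fin n) → unitInterval, QRowHolds i w x) (w : Sym2 (Fin n) → unitInterval) :
    QRowHolds i w (quadmap σ x) := by
  have hw : relabelW σ (fun e => w (sym2Equiv σ e)) = w := by
    funext e
    unfold relabelW
    simp only [Equiv.apply_symm_apply]
  rw [← hw]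
  exact qRowHolds_relabel i σ _ x (h _)

/-! ## The evaluations (quadruple bookkeeping `Quad`, `quadmap`, `distinctQuad`, `cover_quad4/5` from `…FourPointRowsLeFive`) -/

/-- `K₄`: the four rows pass the three-copy check at the standard quadruple (base `2^28`): all `4^6` fibre sums are `≥ 0`. [this work] -/
theorem checkStep4 (i : Fin 4) : checkC 4 28 (qTerms i (quad₀ 4 le_rfl)) = true := by
  fin_cases i <;> native_decide
/-- `K₅`: the four rows pass the three-copy check at the standard quadruple (base `2^40`): all `4^10` fibre sums are `≥ 0`. [this work] -/
theorem checkStep5 (i : Fin 4) : checkC 5 40 (qTerms i (quad₀ 5 (by norm_num))) = true := by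
  fin_cases i <;> native_decide

/-- The rows on `Fin 4`. [this work] -/
theorem qRowHolds_four (i : Fin 4) (w : Sym2 (Fin 4) → unitInterval) (a b c y : Fin 4) (hab : a ≠ b) (hac : a ≠ c) (hay : a ≠ y)
    (hbc : b ≠ c) (hby : b ≠ y) (hcy : c ≠ y) : QRowHolds i w (a, b, c, y) := by
  obtain ⟨σ, hσ⟩ := cover_quad4 _ (mem_distinctQuad hab hac hay hbc hby hcy)
  rw [← hσ]
  exact qRowHolds_forall_relabel i σ (fun w' => checkC_sound 28 _ (checkStep4 i) w') w

/-- The rows on `Fin 5`. [this work] -/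
theorem qRowHolds_five (i : Fin 4) (w : Sym2 (Fin 5) → unitInterval) (a b c y : Fin 5) (hab : a ≠ b) (hac : a ≠ c) (hay : a ≠ y)
    (hbc : b ≠ c) (hby : b ≠ y) (hcy : c ≠ y) : QRowHolds i w (a, b, c, y) := by
  obtain ⟨σ, hσ⟩ := cover_quad5 _ (mem_distinctQuad hab hac hay hbc hby hcy)
  rw [← hσ]
  exact qRowHolds_forall_relabel i σ (fun w' => checkC_sound 40 _ (checkStep5 i) w') w

/-- **The four rows on every weighted graph with at most five vertices**, for all pairwise distinct marked vertices. [this work] -/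
theorem qRowHolds_le_five (i : Fin 4) : ∀ n ≤ 5, ∀ (w : Sym2 (Fin n) → unitInterval) (a b c y : Fin n),
    a ≠ b → a ≠ c → a ≠ y → b ≠ c → b ≠ y → c ≠ y → QRowHolds i w (a, b, c, y) := by
  intro n hn w a b c y hab hac hay hbc hby hcy
  interval_cases n
  · exact a.elim0
  · exact absurd (Subsingleton.elim a b) hab
  · have : c = a ∨ c = b := by omega
    rcases this with h | h
    · exact absurd h.symm hac
    · exact absurd h.symm hbc
  · have : y = a ∨ y = b ∨ y = c := by omega
    rcases this with h | h | h
    · exact absurd h.symm hay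
    · exact absurd h.symm hby
    · exact absurd h.symm hcy
  · exact qRowHolds_four i w a b c y hab hac hay hbc hby hcy
  · exact qRowHolds_five i w a b c y hab hac hay hbc hby hcy

/-! ## The rows in probability notation -/

section Statements

variable (w : Sym2 (Fin n) → unitInterval) (a b c y : Fin n)

/-- `α₁ = μ(a|b|c ∧ y ↔ b)`. [this work] -/
noncomputable def lα₁ : ℝ := (prodBernoulli w).real (connEvent (pA₁ a b c y))
/-- `α₂ = μ(a|b|c ∧ y ↔ c)`. [this work] -/
noncomputable def lα₂ : ℝ := (prodBernoulli w).real (connEvent (pA₂ a b c y))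
/-- `β₁ = μ(ab|c ∧ c ↔ y)`. [this work] -/
noncomputable def lβ₁ : ℝ := (prodBernoulli w).real (connEvent (pB₁ a b c y))
/-- `β₂ = μ(ac|b ∧ b ↔ y)`. [this work] -/
noncomputable def lβ₂ : ℝ := (prodBernoulli w).real (connEvent (pB₂ a b c y))
/-- `β₃ = μ(bc|a ∧ b ↔ y) = μ(a|bcy)`. [this work] -/
noncomputable def lβ₃ : ℝ := (prodBernoulli w).real (connEvent (pB₃ a b c y))

/-- The event `α₁` in `openConn` notation. [this work] -/
theorem connEvent_pA₁ : connEvent (pA₁ a b c y) = (openConn a b)ᶜ ∩ (openConn a c)ᶜ ∩ (openConn b c)ᶜ ∩ openConn y b := by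
  ext ω; simp [connEvent, pA₁, pQ, and_assoc]
/-- The event `α₂` in `openConn` notation. [this work] -/
theorem connEvent_pA₂ : connEvent (pA₂ a b c y) = (openConn a b)ᶜ ∩ (openConn a c)ᶜ ∩ (openConn b c)ᶜ ∩ openConn y c := by
  ext ω; simp [connEvent, pA₂, pQ, and_assoc]
/-- The event `β₁` in `openConn` notation. [this work] -/
theorem connEvent_pB₁ : connEvent (pB₁ a b c y) = openConn a b ∩ (openConn a c)ᶜ ∩ openConn c y := by
  ext ω
  simp only [connEvent, pB₁, pU₁, Set.mem_setOf_eq, Set.mem_inter_iff, Set.mem_compl_iff, Bool.and_eq_true, Bool.not_eq_true',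
    decide_eq_true_eq, decide_eq_false_iff_not]
/-- The event `β₂` in `openConn` notation. [this work] -/
theorem connEvent_pB₂ : connEvent (pB₂ a b c y) = openConn a c ∩ (openConn a b)ᶜ ∩ openConn b y := by
  ext ω
  simp only [connEvent, pB₂, pU₂, Set.mem_setOf_eq, Set.mem_inter_iff, Set.mem_compl_iff, Bool.and_eq_true, Bool.not_eq_true',
    decide_eq_true_eq, decide_eq_false_iff_not]
/-- The event `β₃` in `openConn` notation. [this work] -/
theorem connEvent_pB₃ : connEvent (pB₃ a b c y) = openConn b c ∩ (openConn a b)ᶜ ∩ openConn b y := by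
  ext ω
  simp only [connEvent, pB₃, pU₃, Set.mem_setOf_eq, Set.mem_inter_iff, Set.mem_compl_iff, Bool.and_eq_true, Bool.not_eq_true',
    decide_eq_true_eq, decide_eq_false_iff_not]
/-- The event `D_uv` in `openConn` notation. [this work] -/
theorem connEvent_pD (u v : Fin n) : connEvent (pD u v) = (openConn u v)ᶜ := by
  ext ω; simp [connEvent, pD]
/-- The event `G_ab` in `openConn` notation. [this work] -/
theorem connEvent_pG (u v z : Fin n) : connEvent (pG u v z) = (openConn u v)ᶜ ∩ (openConn z v)ᶜ := by
  ext ω; simp [connEvent, pG]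
/-- The event `G_bc` in `openConn` notation. [this work] -/
theorem connEvent_pGbc : connEvent (pGbc a b c y) =
    (openConn b c)ᶜ ∩ (openConn a b ∩ openConn c y ∪ openConn a c ∩ openConn b y)ᶜ := by
  ext ω
  simp only [connEvent, pGbc, Set.mem_setOf_eq, Set.mem_inter_iff, Set.mem_compl_iff, Set.mem_union, Bool.and_eq_true,
    Bool.not_eq_true', decide_eq_false_iff_not, Bool.or_eq_false_iff, Bool.and_eq_false_iff, not_or, not_and]
  constructor
  · rintro ⟨h1, h2, h3⟩
    refine ⟨h1, fun hab hcy => ?_, fun hac hby => ?_⟩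
    · rcases h2 with h | h
      · exact absurd hab (by simpa using h)
      · exact absurd hcy (by simpa using h)
    · rcases h3 with h | h
      · exact absurd hac (by simpa using h)
      · exact absurd hby (by simpa using h)
  · rintro ⟨h1, h2, h3⟩
    refine ⟨h1, ?_, ?_⟩
    · by_cases hab : ω ∈ openConn a b
      · exact Or.inr (by simpa using h2 hab)
      · exact Or.inl (by simpa using hab)
    · by_cases hac : ω ∈ openConn a c
      · exact Or.inr (by simpa using h3 hac)
      · exact Or.inl (by simpa using hac)

end Statements

/-- The value of row `2` is `threeB₁` at the ten event probabilities. [this work] -/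
theorem cval_qTerms_two (w : Sym2 (Fin n) → unitInterval) (a b c y : Fin n) :
    cval w (qTerms 2 (a, b, c, y)) = threeB₁ (lq w a b c) (lu₁ w a b c) (lu₂ w a b c) (lu₃ w a b c) (lt w a b c)
      (lα₁ w a b c y) (lα₂ w a b c y) (lβ₁ w a b c y) (lβ₂ w a b c y) (lβ₃ w a b c y) := by
  unfold cval qTerms
  simp only [List.map_cons, List.map_nil, List.sum_cons, List.sum_nil]
  unfold pr lq lu₁ lu₂ lu₃ lt lα₁ lα₂ lβ₁ lβ₂ lβ₃ threeB₁
  push_cast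
  ring

/-- The value of row `3` is `threeB₂` at the ten event probabilities. [this work] -/
theorem cval_qTerms_three (w : Sym2 (Fin n) → unitInterval) (a b c y : Fin n) :
    cval w (qTerms 3 (a, b, c, y)) = threeB₂ (lq w a b c) (lu₁ w a b c) (lu₂ w a b c) (lu₃ w a b c) (lt w a b c)
      (lα₁ w a b c y) (lα₂ w a b c y) (lβ₁ w a b c y) (lβ₂ w a b c y) (lβ₃ w a b c y) := by
  unfold cval qTerms
  simp only [List.map_cons, List.map_nil, List.sum_cons, List.sum_nil]
  unfold pr lq lu₁ lu₂ lu₃ lt lα₁ lα₂ lβ₁ lβ₂ lβ₃ threeB₂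
  push_cast
  ring

/-- **(B1),(B2) on at most five vertices.**  For every weighted graph on `n ≤ 5` vertices and all pairwise distinct `a b c y`, both Bernstein
pieces of the SHK3⁺ apex-edge step along `{a,y}` are nonnegative: `0 ≤ threeB₁ q u₁ u₂ u₃ t α₁ α₂ β₁ β₂ β₃` and `0 ≤ threeB₂ …`, where
`(q,u₁,u₂,u₃,t)` is the three-point law of `(a,b,c)` and `α₁ = μ(a|b|c, y↔b)`, `α₂ = μ(a|b|c, y↔c)`, `β₁ = μ(ab|c, c↔y)`, `β₂ = μ(ac|b, b↔y)`,
`β₃ = μ(bc|a, b↔y)` are the apex transition masses (all under `μ = prodBernoulli w` of the graph WITHOUT conditioning on the edge `{a,y}`;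
applied to `G ∖ {a,y}` these are exactly the hypotheses `h₁, h₂` of `F_segment_nonneg_of_bernstein`). [this work] -/
theorem bernsteinStep_le_five : ∀ n ≤ 5, ∀ (w : Sym2 (Fin n) → unitInterval) (a b c y : Fin n),
    a ≠ b → a ≠ c → a ≠ y → b ≠ c → b ≠ y → c ≠ y →
    0 ≤ threeB₁ (lq w a b c) (lu₁ w a b c) (lu₂ w a b c) (lu₃ w a b c) (lt w a b c)
      (lα₁ w a b c y) (lα₂ w a b c y) (lβ₁ w a b c y) (lβ₂ w a b c y) (lβ₃ w a b c y) ∧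
    0 ≤ threeB₂ (lq w a b c) (lu₁ w a b c) (lu₂ w a b c) (lu₃ w a b c) (lt w a b c)
      (lα₁ w a b c y) (lα₂ w a b c y) (lβ₁ w a b c y) (lβ₂ w a b c y) (lβ₃ w a b c y) := by
  intro n hn w a b c y hab hac hay hbc hby hcy
  refine ⟨?_, ?_⟩
  · have h := qRowHolds_le_five 2 n hn w a b c y hab hac hay hbc hby hcy
    unfold QRowHolds at h
    rwa [cval_qTerms_two] at h
  · have h := qRowHolds_le_five 3 n hn w a b c y hab hac hay hbc hby hcy
    unfold QRowHolds at h
    rwa [cval_qTerms_three] at h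

/-- **(L1) on at most five vertices**: `E₃(D_bc, D_ac, G_ab) + E₃(D_bc, G_ac, D_ab) ≥ β₃ · μ(D_bc)` (`E₃ = sahiE3 μ`). [this work] -/
theorem l1_le_five : ∀ n ≤ 5, ∀ (w : Sym2 (Fin n) → unitInterval) (a b c y : Fin n),
    a ≠ b → a ≠ c → a ≠ y → b ≠ c → b ≠ y → c ≠ y →
    (prodBernoulli w).real (openConn b c ∩ (openConn a b)ᶜ ∩ openConn b y) * (prodBernoulli w).real (openConn b c)ᶜ ≤
      sahiE3 (prodBernoulli w) (openConn b c)ᶜ (openConn a c)ᶜ ((openConn a b)ᶜ ∩ (openConn y b)ᶜ) +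
        sahiE3 (prodBernoulli w) (openConn b c)ᶜ ((openConn a c)ᶜ ∩ (openConn y c)ᶜ) (openConn a b)ᶜ := by
  intro n hn w a b c y hab hac hay hbc hby hcy
  have h := qRowHolds_le_five 0 n hn w a b c y hab hac hay hbc hby hcy
  unfold QRowHolds cval qTerms e3Terms at h
  simp only [List.map_append, List.sum_append, List.map_cons, List.map_nil, List.sum_cons, List.sum_nil, pr_pTrue] at h
  unfold pr at h
  simp only [connEvent_pAnd, connEvent_pD, connEvent_pG, connEvent_pB₃] at h
  rw [sahiE3_def, sahiE3_def]
  simp only [← Set.inter_assoc] at h ⊢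
  push_cast at h
  linarith

/-- **(L2) on at most five vertices**: `E₃(D_bc, G_ac, G_ab) + E₃(D_bc, D_ac, G_ab) + E₃(D_bc, G_ac, D_ab) ≥ β₃ · μ(G_bc)`. [this work] -/
theorem l2_le_five : ∀ n ≤ 5, ∀ (w : Sym2 (Fin n) → unitInterval) (a b c y : Fin n),
    a ≠ b → a ≠ c → a ≠ y → b ≠ c → b ≠ y → c ≠ y →
    (prodBernoulli w).real (openConn b c ∩ (openConn a b)ᶜ ∩ openConn b y) *
        (prodBernoulli w).real ((openConn b c)ᶜ ∩ (openConn a b ∩ openConn c y ∪ openConn a c ∩ openConn b y)ᶜ) ≤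
      sahiE3 (prodBernoulli w) (openConn b c)ᶜ ((openConn a c)ᶜ ∩ (openConn y c)ᶜ) ((openConn a b)ᶜ ∩ (openConn y b)ᶜ) +
        sahiE3 (prodBernoulli w) (openConn b c)ᶜ (openConn a c)ᶜ ((openConn a b)ᶜ ∩ (openConn y b)ᶜ) +
        sahiE3 (prodBernoulli w) (openConn b c)ᶜ ((openConn a c)ᶜ ∩ (openConn y c)ᶜ) (openConn a b)ᶜ := by
  intro n hn w a b c y hab hac hay hbc hby hcy
  have h := qRowHolds_le_five 1 n hn w a b c y hab hac hay hbc hby hcy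
  unfold QRowHolds cval qTerms e3Terms at h
  simp only [List.map_append, List.sum_append, List.map_cons, List.map_nil, List.sum_cons, List.sum_nil, pr_pTrue] at h
  unfold pr at h
  simp only [connEvent_pAnd, connEvent_pD, connEvent_pG, connEvent_pB₃, connEvent_pGbc] at h
  rw [sahiE3_def, sahiE3_def, sahiE3_def]
  simp only [← Set.inter_assoc] at h ⊢
  push_cast at h
  linarith

/-! ## The named bounded-n statements -/

/-- **Polarised terminal-edge step up to `N₀` vertices**: (L1) and (L2) for every weighted graph on `n ≤ N₀` vertices and all pairwise
distinct marked vertices `a, b, c, y`. [this work] -/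
def PolarisedStepUpTo (N₀ : ℕ) : Prop :=
  ∀ n ≤ N₀, ∀ (w : Sym2 (Fin n) → unitInterval) (a b c y : Fin n), a ≠ b → a ≠ c → a ≠ y → b ≠ c → b ≠ y → c ≠ y →
    QRowHolds 0 w (a, b, c, y) ∧ QRowHolds 1 w (a, b, c, y)

/-- **Bernstein terminal-edge step up to `N₀` vertices**: (B1) and (B2) (`threeB₁, threeB₂ ≥ 0` at the event probabilities) for every
weighted graph on `n ≤ N₀` vertices and all pairwise distinct `a, b, c, y`. [this work] -/
def BernsteinStepUpTo (N₀ : ℕ) : Prop :=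
  ∀ n ≤ N₀, ∀ (w : Sym2 (Fin n) → unitInterval) (a b c y : Fin n), a ≠ b → a ≠ c → a ≠ y → b ≠ c → b ≠ y → c ≠ y →
    0 ≤ threeB₁ (lq w a b c) (lu₁ w a b c) (lu₂ w a b c) (lu₃ w a b c) (lt w a b c)
      (lα₁ w a b c y) (lα₂ w a b c y) (lβ₁ w a b c y) (lβ₂ w a b c y) (lβ₃ w a b c y) ∧
    0 ≤ threeB₂ (lq w a b c) (lu₁ w a b c) (lu₂ w a b c) (lu₃ w a b c) (lt w a b c)
      (lα₁ w a b c y) (lα₂ w a b c y) (lβ₁ w a b c y) (lβ₂ w a b c y) (lβ₃ w a b c y)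

/-- **Rung `N₀ = 5` of the polarised step.** [this work] -/
theorem polarisedStepUpTo_five : PolarisedStepUpTo 5 := fun n hn w a b c y hab hac hay hbc hby hcy =>
  ⟨qRowHolds_le_five 0 n hn w a b c y hab hac hay hbc hby hcy, qRowHolds_le_five 1 n hn w a b c y hab hac hay hbc hby hcy⟩

/-- **Rung `N₀ = 5` of the Bernstein step.** [this work] -/
theorem bernsteinStepUpTo_five : BernsteinStepUpTo 5 := bernsteinStep_le_five

end Summit.CriticalPhenomena.PercolationContinuityZ3.Theorems.TerminalEdgeStep
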